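import Summits.QuantumFields.QCD.Theorems.WilsonMobilityGapChiralMobilityGapAnchorStubLowerWithOfFloorAndCeiling

/-!
# Crux `ChiralMobilityGap` (stmt-QuantumFields-17497) — line `Ideator3Sketch`: TIGHTNESS of the diagonal
# sandwich (honesty record for skeleton v8)

Skeleton v8 reduces the diagonal content of the crux along the anchored witness to a first-moment FLOOR at a
physical rate `μ` (`stub_floorFinite` / `stub_floorChiral`) and a second-moment CEILING at a physical rate
`δ` (`stub_pionCeiling`).  This file records, sorry-free and for ANY regularisation, that the two rates are
not independent: since `fm(1)² ≤ fm(2)` (Cauchy–Schwarz under the phase-quenched probability measure), a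
floor at rate `μ` and a ceiling at rate `δ` can coexist along one degenerate trajectory only if `δ ≤ 2μ`
(`no_rate_sandwich` at one large `k`, `S = n → ∞`).  Consequences for the line (no new obligation, a CHECK):

* the pion-ceiling rate is at most twice the floor rate, so `stub_floorChiral` (floors at arbitrarily small
  rate) forces the ceiling rate `δ(t)` of `stub_pionCeiling` to be small at the same `t`: any proof of the two
  stubs must produce `δ(t) → 0` along the chiral sequence — the lattice face of `m_π(t) → 0` (GMOR); a pion
  ceiling with a rate bounded below uniformly in `t` would REFUTE `stub_floorChiral` for the same witness;
* physically the sandwich is expected to be tight, `δ = 2μ = m_π(t)` in physical units (the first moment of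
  the propagator entry sum decays at half the pion rate: Parisi–Lepage scaling of correlator magnitudes,
  log-magnitude variance plateauing rather than growing linearly — Wagman–Savage 2017 for baryon correlators).

Contents: `fm_one_le_sqrt_fm_two`, `fm_one_sq_le_fm_two` (degenerate tuple, `N_f ≥ 2`),
`ceilingRate_le_two_mul_floorRate` (the tightness theorem).
-/

noncomputable section

namespace Summit.QuantumFields.QCD.Theorems.ChiralMobilityGapAnchor

open scoped BigOperators Topology
open MeasureTheory Filter Set
open Literature.MathematicalPhysics.QuantumFieldTheory Literature.MathematicalPhysics.QuantumLattice
  Literature.Probability.LatticeModels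
open Summit.QuantumFields.QCD.Theorems.MobilityGapNegative (bare fm ClauseI Upper Lower Sign Clauses
  no_rate_sandwich)
open Summit.QuantumFields.QCD.Theorems.MobilityGapSketch (propSum propSum_nonneg measurable_propSum
  integrable_propSum_rpow fm_eq_expect fm_eq_integral negativeFm_eq_fm)

variable {Nf : ℕ}

/-- **Lyapunov on the diagonal, `N_f ≥ 2`: `fm(1) ≤ fm(2)^{1/2}`** (both are moments of the entry sum under the
phase-quenched probability measure; `X` and `X²` are integrable at a degenerate tuple). -/
theorem fm_one_le_sqrt_fm_two (hNf : 2 ≤ Nf) (β x : ℝ) (S : ℕ) (f : Fin Nf) (v : Site 4) :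
    fm Nf β (fun _ => x) S f v 1 ≤ fm Nf β (fun _ => x) S f v 2 ^ (1 / 2 : ℝ) := by
  have hZ := integral_norm_det_diracMatrix_pos_all (S := 2 * S + 1) β (fun _ : Fin Nf => x)
  have hP0 := propSum_nonneg Nf S (fun _ : Fin Nf => x) f v
  have hi' := integrable_propSum_rpow Nf S β (fun _ : Fin Nf => x) f v
    (by norm_num : (0 : ℝ) ≤ 1) (by norm_num : (1 : ℝ) ≤ 1)
  have hi := integrable_propSum_sq hNf S β x f v
  have hLyap := qcdPhaseQuenchedExpect_rpow_le_rpow (S := 2 * S + 1) β (fun _ : Fin Nf => x) hZ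
    (propSum Nf S (fun _ : Fin Nf => x) f v) hP0 (by norm_num : (0 : ℝ) < 1)
    (by norm_num : (1 : ℝ) ≤ 2) hi' hi
  rw [negativeFm_eq_fm, fm_eq_expect, fm_eq_expect]
  exact hLyap

/-- **Cauchy–Schwarz on the diagonal, `N_f ≥ 2`: `fm(1)² ≤ fm(2)`.** -/
theorem fm_one_sq_le_fm_two (hNf : 2 ≤ Nf) (β x : ℝ) (S : ℕ) (f : Fin Nf) (v : Site 4) :
    fm Nf β (fun _ => x) S f v 1 ^ (2 : ℝ) ≤ fm Nf β (fun _ => x) S f v 2 := by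
  have h1 : 0 ≤ fm Nf β (fun _ => x) S f v 1 := by
    rw [negativeFm_eq_fm, fm_eq_integral]
    exact integral_nonneg fun U => Real.rpow_nonneg (propSum_nonneg Nf S _ f v U) _
  have h2 : 0 ≤ fm Nf β (fun _ => x) S f v 2 := by
    rw [negativeFm_eq_fm, fm_eq_integral]
    exact integral_nonneg fun U => Real.rpow_nonneg (propSum_nonneg Nf S _ f v U) _
  have h := Real.rpow_le_rpow h1 (fm_one_le_sqrt_fm_two hNf β x S f v) (by norm_num : (0 : ℝ) ≤ 2)
  rwa [← Real.rpow_mul h2, show (1 / 2 : ℝ) * 2 = 1 by norm_num, Real.rpow_one] at h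

/-- **TIGHTNESS OF THE SANDWICH.**  For `N_f ≥ 2` identical flavours and ANY regularisation: if along the
degenerate trajectory `(t,…,t)`, eventually in `k`, on every torus `S ≥ L_k` and for every `n ≤ S`, the
first moment of the entry sum has a floor `c e^{-(μ a_k n + q log(n+1))} ≤ fm(1)` (`c > 0`) and the second
moment a ceiling `fm(2) ≤ C e^{-δ a_k n}`, then `δ ≤ 2μ`.  (At one such `k`, with `S = n → ∞`:
`c² e^{-(2μ a_k n + 2q log(n+1))} ≤ fm(1)² ≤ fm(2) ≤ C e^{-δ a_k n}` is a rate sandwich, impossible for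
`2μ a_k < δ a_k` by `no_rate_sandwich`.)  Hence the pion-ceiling rate of `stub_pionCeiling` is at most twice
any floor rate, and `stub_floorChiral` forces it to vanish along the chiral sequence. -/
theorem ceilingRate_le_two_mul_floorRate : ∀ {Nf : ℕ}, 2 ≤ Nf → ∀ (reg : QCDRegularisation Nf) (t : ℝ)
    {c μ q C δ : ℝ}, 0 < c →
    (∀ᶠ k in atTop, ∀ S : ℕ, reg.L k ≤ S → ∀ (f : Fin Nf) (n : ℕ), n ≤ S →
      c * Real.exp (-(μ * (reg.a k * n) + q * Real.log (n + 1))) ≤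
        fm Nf (reg.β k) (bare reg (fun _ => t) k) S f (Pi.single 0 (n : ℤ)) 1) →
    (∀ᶠ k in atTop, ∀ S : ℕ, reg.L k ≤ S → ∀ (f : Fin Nf) (n : ℕ), n ≤ S →
      fm Nf (reg.β k) (bare reg (fun _ => t) k) S f (Pi.single 0 (n : ℤ)) 2 ≤
        C * Real.exp (-(δ * (reg.a k * n)))) →
    δ ≤ 2 * μ := by
  intro Nf hNf reg t c μ q C δ hc hF hC
  refine le_of_not_gt fun hlt => ?_
  obtain ⟨k, hFk, hCk⟩ := (hF.and hC).exists
  have ha : 0 < reg.a k := reg.a_pos k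
  have hAB : 2 * μ * reg.a k < δ * reg.a k := mul_lt_mul_of_pos_right hlt ha
  let f : Fin Nf := ⟨0, lt_of_lt_of_le two_pos hNf⟩
  refine no_rate_sandwich (c₀ := c ^ (2 : ℝ)) (C := C) (A := 2 * μ * reg.a k) (B := δ * reg.a k)
    (p := 2 * q) (Real.rpow_pos_of_pos hc _) hAB (reg.L k) fun n hn => ?_
  -- at `S = n ≥ L_k`: floor² ≤ fm(1)² ≤ fm(2) ≤ ceiling
  set x : ℝ := reg.mcrit k + reg.a k * t / reg.Zm k with hx
  have h1 : c * Real.exp (-(μ * (reg.a k * n) + q * Real.log (n + 1))) ≤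
      fm Nf (reg.β k) (fun _ : Fin Nf => x) n f (Pi.single 0 (n : ℤ)) 1 := hFk n hn f n le_rfl
  have h2 : fm Nf (reg.β k) (fun _ : Fin Nf => x) n f (Pi.single 0 (n : ℤ)) 2 ≤
      C * Real.exp (-(δ * (reg.a k * n))) := hCk n hn f n le_rfl
  have hE0 : 0 ≤ c * Real.exp (-(μ * (reg.a k * n) + q * Real.log (n + 1))) :=
    (mul_pos hc (Real.exp_pos _)).le
  have hsq := Real.rpow_le_rpow hE0 h1 (by norm_num : (0 : ℝ) ≤ 2)
  have hchain := (hsq.trans (fm_one_sq_le_fm_two hNf (reg.β k) x n f (Pi.single 0 (n : ℤ)))).trans h2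
  -- rewrite the two ends into the `no_rate_sandwich` shape
  have hL : (c * Real.exp (-(μ * (reg.a k * n) + q * Real.log (n + 1)))) ^ (2 : ℝ) =
      c ^ (2 : ℝ) * Real.exp (-(2 * μ * reg.a k * n + 2 * q * Real.log (n + 1))) := by
    rw [Real.mul_rpow hc.le (Real.exp_pos _).le, ← Real.exp_mul]
    congr 1
    congr 1
    ring
  have hR : C * Real.exp (-(δ * (reg.a k * n))) = C * Real.exp (-(δ * reg.a k * n)) := by
    rw [mul_assoc]
  rw [hL, hR] at hchain
  exact hchain

end Summit.QuantumFields.QCD.Theorems.ChiralMobilityGapAnchor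

end
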